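import Mathlib.LinearAlgebra.Quotient.Basic
import Mathlib.RingTheory.Ideal.Span
import Mathlib.RingTheory.Ideal.Operations
import Mathlib.Tactic.LinearCombination
import Mathlib.Tactic.Ring
import HarnessLib

/-!
# Route `SignedLowerHalves`, crux L `SmallImageLowerHalfBothSigns` (stmt-BirchSwinnertonDyer-23599), line `rtt_w3` v30 — stub S3β″ (`stub_junctionPT_ns`), input N5-(iii) (unramified generator),
# algebraic component C5: THE ANNIHILATOR OF THE GENERATOR IN A FROBENIUS QUOTIENT `B ⧸ (φ − 1)B` OF A CYCLIC MODULE

WIDTH seat `bsd-line-slh-p3-w3` g26 under LEAD `cruxlead-stmt-BirchSwinnertonDyer-23599` g14 (cell `bsd-ssimc`); helper `--supports stmt-BirchSwinnertonDyer-23599`. THEOREMS ONLY.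
HONEST FRAMING: pure module algebra for the plan `Lines/rtt_w3-DESIGN-N5iii-w3-g26.md` §2 C5: the level `(n,k)` of the unramified generator lives in
`H¹_ur(K_w, N_{n,k}) ≅ N_{n,k} ⧸ (φ_w − 1)N_{n,k}` (evaluation at Frobenius), `N_{n,k} = Λ_𝒪 · b₀` cyclic with `Ann(b₀) = (p^k, ω_n)` and `φ_w b₀ = v · b₀` (`v = u·(1+T)^{-x_w}`); this file
computes `Ann([b₀]) = Ann(b₀) + (v − 1)` in that abstract situation. Nothing about S3β″, crux L or BSD is proved; all remain OPEN and are proved for NO curve.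

* ★ `smul_mkQ_range_sub_eq_zero_iff` — for `B = R·b₀` with `Ann(b₀) = J` and `φ b₀ = v • b₀` (`φ` `R`-linear): `f • [b₀] = 0` in `B ⧸ range(φ − 1)` iff `f ∈ J ⊔ (v − 1)`.
* `smul_mkQ_range_sub_eq_zero_iff_of_isUnit` — the same with `(v − 1)` replaced by `(w − v′)` for `v = v′·w⁻¹`, `w` a unit (the form `P_w = (1+T)^{x_w} − u`).
References: [Washington1997] §13.2; [SerreLocalFields1979] XIII §1 Prop. 1 (`H¹(Ẑ, B) = B/(φ−1)B`).
-/

set_option autoImplicit false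
set_option linter.dupNamespace false -- D-0017: single-problem summit, the namespace repeats the problem name by design

namespace Summit.BirchSwinnertonDyer.BirchSwinnertonDyer.Theorems.SmallImageRttD2Seq

variable {R : Type*} [CommRing R] {B : Type*} [AddCommGroup B] [Module R B]

/-- ★ **The annihilator of the generator in the Frobenius quotient of a cyclic module**: if `B = R · b₀` with `Ann(b₀) = J` and `φ b₀ = v • b₀` for an `R`-linear `φ`, then
`f • [b₀] = 0` in `B ⧸ (φ − 1)B` iff `f ∈ J + (v − 1)` (`(φ − 1)(r b₀) = r(v − 1) b₀`). [cite: SerreLocalFields1979, XIII §1 Prop. 1] [cite: Washington1997, §13.2] -/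
theorem smul_mkQ_range_sub_eq_zero_iff (b₀ : B) (hcyc : ∀ b : B, ∃ r : R, b = r • b₀) (J : Ideal R) (hJ : ∀ r : R, r • b₀ = 0 ↔ r ∈ J)
    (φ : B →ₗ[R] B) (v : R) (hφ : φ b₀ = v • b₀) (f : R) :
    f • (LinearMap.range (φ - LinearMap.id)).mkQ b₀ = 0 ↔ f ∈ J ⊔ Ideal.span {v - 1} := by
  have hφr : ∀ r : R, (φ - LinearMap.id : B →ₗ[R] B) (r • b₀) = (r * (v - 1)) • b₀ := fun r ↦ by
    rw [LinearMap.sub_apply, LinearMap.id_apply, map_smul, hφ, smul_smul, mul_sub, mul_one, sub_smul]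
  rw [← map_smul, Submodule.mkQ_apply, Submodule.Quotient.mk_eq_zero, LinearMap.mem_range]
  constructor
  · rintro ⟨b, hb⟩
    obtain ⟨r, rfl⟩ := hcyc b
    rw [hφr] at hb
    have h0 : (f - r * (v - 1)) • b₀ = 0 := by rw [sub_smul, hb, sub_self]
    have hmem := (hJ _).mp h0
    exact Submodule.mem_sup.mpr ⟨f - r * (v - 1), hmem, r * (v - 1), Ideal.mem_span_singleton'.mpr ⟨r, rfl⟩, sub_add_cancel _ _⟩
  · intro hf
    obtain ⟨j, hj, s, hs, hjs⟩ := Submodule.mem_sup.mp hf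
    obtain ⟨r, rfl⟩ := Ideal.mem_span_singleton'.mp hs
    refine ⟨r • b₀, ?_⟩
    rw [hφr, ← hjs, add_smul, (hJ j).mpr hj, zero_add]

/-- **The same with a unit rescaling of the eigenvalue**: if `φ b₀ = v • b₀` with `v * w = v′` for a unit `w` (intended `w = (1+T)^{x_w}`, `v′ = u`, `v = u(1+T)^{-x_w}`), then
`f • [b₀] = 0` iff `f ∈ J + (w − v′)` — the ideal `(p^k, ω_n) + (P_w)` with `P_w = (1+T)^{x_w} − u`. [cite: Washington1997, §13.2] -/
theorem smul_mkQ_range_sub_eq_zero_iff_of_isUnit (b₀ : B) (hcyc : ∀ b : B, ∃ r : R, b = r • b₀) (J : Ideal R) (hJ : ∀ r : R, r • b₀ = 0 ↔ r ∈ J)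
    (φ : B →ₗ[R] B) {v v' w : R} (hw : IsUnit w) (hvw : v * w = v') (hφ : φ b₀ = v • b₀) (f : R) :
    f • (LinearMap.range (φ - LinearMap.id)).mkQ b₀ = 0 ↔ f ∈ J ⊔ Ideal.span {w - v'} := by
  rw [smul_mkQ_range_sub_eq_zero_iff b₀ hcyc J hJ φ v hφ f]
  have hspan : Ideal.span {v - 1} = Ideal.span {w - v'} := by
    obtain ⟨wu, rfl⟩ := hw
    have h1 : (-(wu : R)) * (v - 1) = wu - v' := by rw [← hvw]; ring
    have h2 : (-((wu⁻¹ : Rˣ) : R)) * (wu - v') = v - 1 := by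
      rw [← hvw]
      linear_combination (v - 1) * wu.inv_mul
    exact le_antisymm ((Ideal.span_singleton_le_iff_mem _).mpr (Ideal.mem_span_singleton'.mpr ⟨_, h2⟩))
      ((Ideal.span_singleton_le_iff_mem _).mpr (Ideal.mem_span_singleton'.mpr ⟨_, h1⟩))
  rw [hspan]

end Summit.BirchSwinnertonDyer.BirchSwinnertonDyer.Theorems.SmallImageRttD2Seq
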